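import Summits.BirchSwinnertonDyer.BirchSwinnertonDyer.Theorems.KimAtThreeFineKatoExpStarGalois
import Summits.BirchSwinnertonDyer.BirchSwinnertonDyer.Theorems.KimAtThreeFineKatoValueEquivarianceLocal
import Summits.BirchSwinnertonDyer.BirchSwinnertonDyer.Theorems.KimAtThreeDeepLowerExpStarOmegaPlace
import HarnessLib

/-!
# `ZetaBody` (C3a) for the single-completion value datum is KERNEL from hKatoV2₀'s own clauses:
# the LEAD's (GAL_loc) for the defined `exp*_ω` instantiated at `ℚ_v ⊆ ℚ(ζ_m)_{w₀}`
# (crux `KatoKuriharaPortThreeShared`, stmt-BirchSwinnertonDyer-19560; cell `bsd-addord`, seat w2-acc5 gen 5;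
# route W2 `KimAtThreeKolyvagin`; `--supports 19560`, helper)

HONEST FRAMING.  TOOL theorems only (no definition, no named fact, no instance, no `sorry`); general prime
`p` and level `(k, r)`; closes nothing; nothing is booked; BSD is not proved by any of this.

WHAT.  The chain behind the (C3a) clause («`Λ` is `Gal(ℚ(μ_m)/ℚ)`-equivariant», Kato §9.4) of
`ZetaBody` for the value datum `Λ` DEFINED through ONE completion `w₀ ∣ p` of `L = ℚ(ζ_m)` (hKatoV2₀'s
(DEF₀), kim3 `KimAtThreeFineKatoPerFactorPartsSingle`) is, in the kernel,
(C3a) ⟸ (DEF₀) + (GAL_loc) (`KimAtThreeFineKatoValueEquivarianceLocal.zetaBody_C3a_of_cocycleDef_of_galLoc`),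
and (GAL_loc) — «`exp*_{w₀}[res_ℚ δ' · c ∘ s_{δ'}] = (g̃_{δ'})_* exp*_{w₀}[c]`» — is the LEAD's
`KimAtThreeFineKatoExpStarGalois.expStarOmega_galois` (kim3 g15, p512976) read at `K = ℚ_v`,
`L = ℚ(ζ_m)_{w₀}`, `g = galAdicCompletionMap g̃`.  THIS FILE performs that instantiation:

* §1 `isScalarTower_padic_place_adicCompletion` — `ℚ_p → ℚ_v → L_{w₀}` is a scalar tower for the
  canonical (unique continuous) `ℚ_p`-structures (`LocalField.eq_algebraMap_adicCompletionPadicAlgebra`).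
* §2 `galLoc_expStarOmegaHom` — **(GAL_loc) for `φ₀ = expStarOmegaHom` at `L_{w₀}`**, in the binder shape
  of `…ValueEquivarianceLocal` (`c' τ = ρ(res_ℚ δ') (c (s τ))`, conclusion through
  `galAdicCompletionMap (sigma m (χ_m (res_ℚ δ')))`), from hKatoV2₀'s displayed data at `w₀`: the Néron
  lines `d` (at `v`) and `dw` (at `w₀`), the Prop-1.2.3 binders at `w₀`, (RES₀), and ONE class `h₀` with
  `exp*_d h₀ ≠ 0`.  Inputs: `expStarOmega_galois` with `s` any conjugation transport,
  `hg = absClosureEmbedding_smul_eq_galAdicCompletionMap` (Local §2), `hgK =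
  galAdicCompletionMap_algebraMap_adicCompletion` (PadicTensorCompletionGaloisProofs), §1, and the
  continuity of `ℚ_v → L_{w₀}` (`adicCompletionSemialgHom_continuous`).
* §3 `zetaBody_C3a_of_cocycleDef_expStar` — ★ **`ZetaBody` (C3a) VERBATIM, every level, from (DEF₀) with
  `φ₀ = expStarOmegaHom … dw …` + (RES₀) + `h₀`** — no Galois-side and no `exp*`-side hypothesis left
  (`s_{δ'} := absGaloisOuterConj ℚ_v L_{w₀} δ'⁻¹`, `L_{w₀}/ℚ_v` Galois by
  `isGalois_adicCompletion_cyclotomicField`).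

So the supplier of hKatoV2₀ (the Kato-v2 typer lane) owes for `ZetaBody`'s (C3a)/(C3b) NOTHING beyond its
own displayed clauses ((DEF₀) at every level it defines `Λ` by the single-completion recipe, (RES₀), one
`h₀` — on the Kato stratum `exp*_d(H¹) = ℤ_p ∋ 1`).

References: K. Kato, Astérisque 295 (2004) §9.4 (p. 188) [Kato2004Asterisque]; K. Kato, LNM 1553 (1993)
Ch. II §1.2 [Kato1993LNM1553]; J. Neukirch, *Algebraic Number Theory* (1999) Ch. II §9–§10
[NeukirchANT1999]; J.-P. Serre, *Local Fields* (1979) II §3, VII §5 [SerreLocalFields1979].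
-/

noncomputable section

-- the cell's Theorems namespace `Summit.BirchSwinnertonDyer.BirchSwinnertonDyer.…` repeats the summit name by design (D-0017)
set_option linter.dupNamespace false

open scoped Classical NumberField TensorProduct ContRepresentation Pointwise
open Field ValuativeRel Function IsDedekindDomain NumberField
open WeierstrassCurve Literature.NumberTheory.EllipticCurves Literature.NumberTheory.GaloisRepresentations
  Literature.NumberTheory.GaloisRepresentations.DiscreteGaloisModule Literature.NumberTheory.GaloisCohomology
open Literature.NumberTheory.GaloisRepresentations.PeriodRingData Literature.NumberTheory.PAdicHodge
open Literature.NumberTheory.EllipticCurves.Kato2004 Literature.NumberTheory.EllipticCurves.Kato2004.EulerSystemValues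
open Literature.NumberTheory.AdelicBaseChange Literature.NumberTheory.Automorphic
open Summit.BirchSwinnertonDyer.Rank1Residual.GaloisImage
open Summit.BirchSwinnertonDyer.BirchSwinnertonDyer.Theorems.KimAtThreeDeepLowerExpStarOmega
open Summit.BirchSwinnertonDyer.BirchSwinnertonDyer.Theorems.KimAtThreeDeepLowerExpStarOmegaPlace
open Summit.BirchSwinnertonDyer.BirchSwinnertonDyer.Theorems.KimAtThreeFineKatoExpStarGalois
open Summit.BirchSwinnertonDyer.BirchSwinnertonDyer.Theorems.KimAtThreeFineKatoValueEquivarianceLocal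

namespace Summit.BirchSwinnertonDyer.BirchSwinnertonDyer.Theorems.KimAtThreeFineKatoValueEquivarianceExpStar

variable (W : WeierstrassCurve ℚ) [W.IsElliptic] (p : ℕ) [hp : Fact p.Prime]
  [ContinuousSMul ℤ_[p] (W.tateModule p)] (k : ℕ) (r : Finset (HeightOneSpectrum (𝓞 ℚ)))
  (w₀ : ((Rat.HeightOneSpectrum.primesEquiv (R := 𝓞 ℚ)).symm ⟨p, Fact.out⟩).Extension
      (𝓞 (CyclotomicField (cycLevel p k r) ℚ)))
  (hv₀ : ((p : ℕ) : 𝓞 ℚ) ∈ ((Rat.HeightOneSpectrum.primesEquiv (R := 𝓞 ℚ)).symm ⟨p, Fact.out⟩).asIdeal)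
  (hw₀ : ((p : ℕ) : 𝓞 (CyclotomicField (cycLevel p k r) ℚ)) ∈ w₀.1.asIdeal)

/-! ## §1. `ℚ_p → ℚ_v → L_{w₀}` is a scalar tower -/

omit [ContinuousSMul ℤ_[p] (W.tateModule p)] in
set_option backward.isDefEq.respectTransparency false in
/-- **`ℚ_p → ℚ_v → L_{w₀}` is a scalar tower** for the canonical `ℚ_p`-algebra structures of the place
file (`padicAlgebraPlace`) and of the local field `L_{w₀}` (`LocalField.adicCompletionPadicAlgebra`): both
are the unique CONTINUOUS ring maps out of `ℚ_p`, and `ℚ_v → L_{w₀}` is continuous.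
[cite: SerreLocalFields1979, Ch. II §3] -/
theorem isScalarTower_padic_place_adicCompletion :
    haveI : Fact (((p : ℕ) : 𝓞 ℚ) ∈ ((Rat.HeightOneSpectrum.primesEquiv (R := 𝓞 ℚ)).symm ⟨p, Fact.out⟩).asIdeal) := ⟨hv₀⟩
    letI := topologicalSpacePlace ((Rat.HeightOneSpectrum.primesEquiv (R := 𝓞 ℚ)).symm ⟨p, Fact.out⟩)
    letI := padicAlgebraPlace p ((Rat.HeightOneSpectrum.primesEquiv (R := 𝓞 ℚ)).symm ⟨p, Fact.out⟩)
    letI := LocalField.adicCompletionPadicAlgebra w₀.1 p hw₀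
    ∀ [Algebra (Place.Completion (Sum.inr ((Rat.HeightOneSpectrum.primesEquiv (R := 𝓞 ℚ)).symm ⟨p, Fact.out⟩)))
        (w₀.1.adicCompletion (CyclotomicField (cycLevel p k r) ℚ))],
      Continuous (algebraMap (Place.Completion (Sum.inr ((Rat.HeightOneSpectrum.primesEquiv (R := 𝓞 ℚ)).symm ⟨p, Fact.out⟩)))
        (w₀.1.adicCompletion (CyclotomicField (cycLevel p k r) ℚ))) →
      IsScalarTower ℚ_[p] (Place.Completion (Sum.inr ((Rat.HeightOneSpectrum.primesEquiv (R := 𝓞 ℚ)).symm ⟨p, Fact.out⟩)))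
        (w₀.1.adicCompletion (CyclotomicField (cycLevel p k r) ℚ)) := by
  intro _ hcont
  haveI : Fact (((p : ℕ) : 𝓞 ℚ) ∈ ((Rat.HeightOneSpectrum.primesEquiv (R := 𝓞 ℚ)).symm ⟨p, Fact.out⟩).asIdeal) := ⟨hv₀⟩
  letI := topologicalSpacePlace ((Rat.HeightOneSpectrum.primesEquiv (R := 𝓞 ℚ)).symm ⟨p, Fact.out⟩)
  letI := padicAlgebraPlace p ((Rat.HeightOneSpectrum.primesEquiv (R := 𝓞 ℚ)).symm ⟨p, Fact.out⟩)
  letI := LocalField.adicCompletionPadicAlgebra w₀.1 p hw₀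
  refine IsScalarTower.of_algebraMap_eq' ?_
  exact (LocalField.eq_algebraMap_adicCompletionPadicAlgebra w₀.1 p hw₀ _
    (hcont.comp (LocalField.continuous_algebraMap_adicCompletionPadicAlgebra
      ((Rat.HeightOneSpectrum.primesEquiv (R := 𝓞 ℚ)).symm ⟨p, Fact.out⟩) p hv₀))).symm

/-! ## §2. (GAL_loc) for `φ₀ = expStarOmegaHom` at `L_{w₀}` -/

set_option backward.isDefEq.respectTransparency false in
/-- **(GAL_loc) for the defined `exp*_{w₀}`** — the LEAD's `expStarOmega_galois` instantiated at
`K = ℚ_v ⊆ L_{w₀} = ℚ(ζ_m)_{w₀}`, `r = galRestrictPlace v`, `g = galAdicCompletionMap (sigma m (χ_m(res_ℚ δ')))`: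
for tower cocycles `c, c'` with `c' τ = res_ℚ δ' • c (s τ)` (`s` any conjugation transport,
`res (s τ) = δ'⁻¹ res τ δ'`), **`exp*_{dw}[c'] = (g̃_{δ'})_* (exp*_{dw}[c])`**, given hKatoV2₀'s data at `w₀`:
Néron lines `d` at `v` and `dw` at `w₀`, the Prop-1.2.3 binders at `w₀`, (RES₀)
`exp*_{dw} ∘ res = (ℚ_v → L_{w₀}) ∘ exp*_d`, one class `h₀` with `exp*_d h₀ ≠ 0`.
[cite: Kato2004Asterisque, §9.4 (p. 188)] [cite: Kato1993LNM1553, Ch. II §1.2.4 and Prop. 1.2.3]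
[cite: NeukirchANT1999, Ch. II §9 Prop. (9.6) and §10] -/
theorem galLoc_expStarOmegaHom :
    haveI : Fact (((p : ℕ) : 𝓞 ℚ) ∈ ((Rat.HeightOneSpectrum.primesEquiv (R := 𝓞 ℚ)).symm ⟨p, Fact.out⟩).asIdeal) := ⟨hv₀⟩
    letI := LocalField.charZero_adicCompletion w₀.1
    letI := LocalField.adicCompletionPadicAlgebra w₀.1 p hw₀
    haveI : Fact (¬ IsUnit ((p : ℕ) : integerC (w₀.1.adicCompletion (CyclotomicField (cycLevel p k r) ℚ)))) :=
      ⟨not_isUnit_natCast_integerC (LocalField.valuation_adicCompletion_natCast_lt_one w₀.1 p hw₀)⟩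
    haveI := isAdicComplete_integerC_natCast (LocalField.valuation_adicCompletion_natCast_lt_one w₀.1 p hw₀)
    ∀ (d : LocalNeronLineAt W p ((Rat.HeightOneSpectrum.primesEquiv (R := 𝓞 ℚ)).symm ⟨p, Fact.out⟩))
      (dw : LocalNeronLine W (LocalField.valuation_adicCompletion_natCast_lt_one w₀.1 p hw₀)
        ((galRestrictPlace ((Rat.HeightOneSpectrum.primesEquiv (R := 𝓞 ℚ)).symm ⟨p, Fact.out⟩)).comp
          (absGaloisRestrict (((Rat.HeightOneSpectrum.primesEquiv (R := 𝓞 ℚ)).symm ⟨p, Fact.out⟩).adicCompletion ℚ) (w₀.1.adicCompletion (CyclotomicField (cycLevel p k r) ℚ)))))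
      (hinjw : (bdRPeriodRingData (LocalField.valuation_adicCompletion_natCast_lt_one w₀.1 p hw₀)).CupLogInjective
        (logCyclotomic p) (localRationalTateRep W p ((galRestrictPlace ((Rat.HeightOneSpectrum.primesEquiv (R := 𝓞 ℚ)).symm ⟨p, Fact.out⟩)).comp
          (absGaloisRestrict (((Rat.HeightOneSpectrum.primesEquiv (R := 𝓞 ℚ)).symm ⟨p, Fact.out⟩).adicCompletion ℚ) (w₀.1.adicCompletion (CyclotomicField (cycLevel p k r) ℚ))))))
      (hexw : ∀ z : contOneCocycles (localRationalTateRep W p ((galRestrictPlace ((Rat.HeightOneSpectrum.primesEquiv (R := 𝓞 ℚ)).symm ⟨p, Fact.out⟩)).comp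
          (absGaloisRestrict (((Rat.HeightOneSpectrum.primesEquiv (R := 𝓞 ℚ)).symm ⟨p, Fact.out⟩).adicCompletion ℚ) (w₀.1.adicCompletion (CyclotomicField (cycLevel p k r) ℚ))))).toTopRep,
        (bdRPeriodRingData (LocalField.valuation_adicCompletion_natCast_lt_one w₀.1 p hw₀)).HasDualExp
          (logCyclotomic p) (localRationalTateRep W p ((galRestrictPlace ((Rat.HeightOneSpectrum.primesEquiv (R := 𝓞 ℚ)).symm ⟨p, Fact.out⟩)).comp
          (absGaloisRestrict (((Rat.HeightOneSpectrum.primesEquiv (R := 𝓞 ℚ)).symm ⟨p, Fact.out⟩).adicCompletion ℚ) (w₀.1.adicCompletion (CyclotomicField (cycLevel p k r) ℚ))))) fun σ => z.1 σ)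
      (hres : ∀ (h : (tateLocalRep W p (Sum.inr ((Rat.HeightOneSpectrum.primesEquiv (R := 𝓞 ℚ)).symm ⟨p, Fact.out⟩))).cohomology 1),
        (expStarOmegaHom (LocalField.valuation_adicCompletion_natCast_lt_one w₀.1 p hw₀)
          ((galRestrictPlace ((Rat.HeightOneSpectrum.primesEquiv (R := 𝓞 ℚ)).symm ⟨p, Fact.out⟩)).comp
          (absGaloisRestrict (((Rat.HeightOneSpectrum.primesEquiv (R := 𝓞 ℚ)).symm ⟨p, Fact.out⟩).adicCompletion ℚ) (w₀.1.adicCompletion (CyclotomicField (cycLevel p k r) ℚ)))) dw hinjw hexw)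
          (ContinuousRep.cohomologyRes (tateLocalRep W p (Sum.inr ((Rat.HeightOneSpectrum.primesEquiv (R := 𝓞 ℚ)).symm ⟨p, Fact.out⟩)))
            (absGaloisRestrict (((Rat.HeightOneSpectrum.primesEquiv (R := 𝓞 ℚ)).symm ⟨p, Fact.out⟩).adicCompletion ℚ) (w₀.1.adicCompletion (CyclotomicField (cycLevel p k r) ℚ))) 1 h) =
        algebraMap (((Rat.HeightOneSpectrum.primesEquiv (R := 𝓞 ℚ)).symm ⟨p, Fact.out⟩).adicCompletion ℚ) (w₀.1.adicCompletion (CyclotomicField (cycLevel p k r) ℚ)) (expStarOmegaAt d h))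
      (h₀ : (tateLocalRep W p (Sum.inr ((Rat.HeightOneSpectrum.primesEquiv (R := 𝓞 ℚ)).symm ⟨p, Fact.out⟩))).cohomology 1)
      (hh₀ : expStarOmegaAt d h₀ ≠ 0)
      (δ' : absoluteGaloisGroup (((Rat.HeightOneSpectrum.primesEquiv (R := 𝓞 ℚ)).symm ⟨p, Fact.out⟩).adicCompletion ℚ))
      (hδ : sigma (cycLevel p k r) (modNCyclotomicCharacter ℚ (cycLevel p k r)
        (absGaloisRestrict ℚ (((Rat.HeightOneSpectrum.primesEquiv (R := 𝓞 ℚ)).symm ⟨p, Fact.out⟩).adicCompletion ℚ) δ')) • w₀.1 = w₀.1)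
      (s : absoluteGaloisGroup (w₀.1.adicCompletion (CyclotomicField (cycLevel p k r) ℚ)) →ₜ*
        absoluteGaloisGroup (w₀.1.adicCompletion (CyclotomicField (cycLevel p k r) ℚ)))
      (hs : ∀ τ, absGaloisRestrict (((Rat.HeightOneSpectrum.primesEquiv (R := 𝓞 ℚ)).symm ⟨p, Fact.out⟩).adicCompletion ℚ) (w₀.1.adicCompletion (CyclotomicField (cycLevel p k r) ℚ)) (s τ) =
        δ'⁻¹ * absGaloisRestrict (((Rat.HeightOneSpectrum.primesEquiv (R := 𝓞 ℚ)).symm ⟨p, Fact.out⟩).adicCompletion ℚ) (w₀.1.adicCompletion (CyclotomicField (cycLevel p k r) ℚ)) τ * δ')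
      (c c' : contOneCocycles ((tateLocalRep W p (Sum.inr ((Rat.HeightOneSpectrum.primesEquiv (R := 𝓞 ℚ)).symm ⟨p, Fact.out⟩))).restrict
        (absGaloisRestrict (((Rat.HeightOneSpectrum.primesEquiv (R := 𝓞 ℚ)).symm ⟨p, Fact.out⟩).adicCompletion ℚ) (w₀.1.adicCompletion (CyclotomicField (cycLevel p k r) ℚ)))).toTopRep),
      (∀ τ, c'.1 τ = (tateRep W p).toTopRep.ρ (absGaloisRestrict ℚ (((Rat.HeightOneSpectrum.primesEquiv (R := 𝓞 ℚ)).symm ⟨p, Fact.out⟩).adicCompletion ℚ) δ') (c.1 (s τ))) →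
      (expStarOmegaHom (LocalField.valuation_adicCompletion_natCast_lt_one w₀.1 p hw₀)
          ((galRestrictPlace ((Rat.HeightOneSpectrum.primesEquiv (R := 𝓞 ℚ)).symm ⟨p, Fact.out⟩)).comp
          (absGaloisRestrict (((Rat.HeightOneSpectrum.primesEquiv (R := 𝓞 ℚ)).symm ⟨p, Fact.out⟩).adicCompletion ℚ) (w₀.1.adicCompletion (CyclotomicField (cycLevel p k r) ℚ)))) dw hinjw hexw)
        (oneCocycleClass _ c') =
      galAdicCompletionMap (sigma (cycLevel p k r) (modNCyclotomicCharacter ℚ (cycLevel p k r)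
          (absGaloisRestrict ℚ (((Rat.HeightOneSpectrum.primesEquiv (R := 𝓞 ℚ)).symm ⟨p, Fact.out⟩).adicCompletion ℚ) δ'))) hδ
        ((expStarOmegaHom (LocalField.valuation_adicCompletion_natCast_lt_one w₀.1 p hw₀)
          ((galRestrictPlace ((Rat.HeightOneSpectrum.primesEquiv (R := 𝓞 ℚ)).symm ⟨p, Fact.out⟩)).comp
          (absGaloisRestrict (((Rat.HeightOneSpectrum.primesEquiv (R := 𝓞 ℚ)).symm ⟨p, Fact.out⟩).adicCompletion ℚ) (w₀.1.adicCompletion (CyclotomicField (cycLevel p k r) ℚ)))) dw hinjw hexw)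
          (oneCocycleClass _ c)) := by
  intro d dw hinjw hexw hres h₀ hh₀ δ' hδ s hs c c' hcc'
  -- `g = (g̃)_*` fixes `ℚ_v` and is induced by `δ'` (w2-acc5 p504574, Local §2) — elaborated before the place
  -- instances are installed, so that no `ℚ`-algebra structure on `ℚ_v` is re-inferred
  have hgK := fun x => galAdicCompletionMap_algebraMap_adicCompletion _
    (sigma (cycLevel p k r) (modNCyclotomicCharacter ℚ (cycLevel p k r)
      (absGaloisRestrict ℚ (((Rat.HeightOneSpectrum.primesEquiv (R := 𝓞 ℚ)).symm ⟨p, Fact.out⟩).adicCompletion ℚ) δ'))) w₀ w₀ hδ x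
  have hg := absClosureEmbedding_smul_eq_galAdicCompletionMap p k r w₀ δ' hδ
  have hcc'' : ∀ τ, c'.1 τ = galRestrictPlace ((Rat.HeightOneSpectrum.primesEquiv (R := 𝓞 ℚ)).symm ⟨p, Fact.out⟩) δ' •
      c.1 (s τ) := fun τ => by rw [hcc']; rfl
  -- the place instances of `ℚ_v` (`KimAtThreeDeepLowerExpStarOmegaPlace`) and `ℚ_v → L_{w₀}`
  haveI : Fact (((p : ℕ) : 𝓞 ℚ) ∈ ((Rat.HeightOneSpectrum.primesEquiv (R := 𝓞 ℚ)).symm ⟨p, Fact.out⟩).asIdeal) := ⟨hv₀⟩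
  letI := valuativeRelPlace ((Rat.HeightOneSpectrum.primesEquiv (R := 𝓞 ℚ)).symm ⟨p, Fact.out⟩)
  letI := topologicalSpacePlace ((Rat.HeightOneSpectrum.primesEquiv (R := 𝓞 ℚ)).symm ⟨p, Fact.out⟩)
  haveI := isNonarchimedeanLocalField_place ((Rat.HeightOneSpectrum.primesEquiv (R := 𝓞 ℚ)).symm ⟨p, Fact.out⟩)
  haveI := charZero_place ((Rat.HeightOneSpectrum.primesEquiv (R := 𝓞 ℚ)).symm ⟨p, Fact.out⟩)
  letI := padicAlgebraPlace p ((Rat.HeightOneSpectrum.primesEquiv (R := 𝓞 ℚ)).symm ⟨p, Fact.out⟩)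
  haveI := fact_not_isUnit_place p ((Rat.HeightOneSpectrum.primesEquiv (R := 𝓞 ℚ)).symm ⟨p, Fact.out⟩)
  haveI := isAdicComplete_place p ((Rat.HeightOneSpectrum.primesEquiv (R := 𝓞 ℚ)).symm ⟨p, Fact.out⟩)
  letI := LocalField.charZero_adicCompletion w₀.1
  letI := LocalField.adicCompletionPadicAlgebra w₀.1 p hw₀
  haveI : Fact (¬ IsUnit ((p : ℕ) : integerC (w₀.1.adicCompletion (CyclotomicField (cycLevel p k r) ℚ)))) :=
    ⟨not_isUnit_natCast_integerC (LocalField.valuation_adicCompletion_natCast_lt_one w₀.1 p hw₀)⟩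
  haveI := isAdicComplete_integerC_natCast (LocalField.valuation_adicCompletion_natCast_lt_one w₀.1 p hw₀)
  letI instKL : Algebra (Place.Completion (Sum.inr ((Rat.HeightOneSpectrum.primesEquiv (R := 𝓞 ℚ)).symm ⟨p, Fact.out⟩)))
      (w₀.1.adicCompletion (CyclotomicField (cycLevel p k r) ℚ)) :=
    (inferInstance : Algebra (((Rat.HeightOneSpectrum.primesEquiv (R := 𝓞 ℚ)).symm ⟨p, Fact.out⟩).adicCompletion ℚ)
      (w₀.1.adicCompletion (CyclotomicField (cycLevel p k r) ℚ)))
  have hcont : Continuous (algebraMap (Place.Completion (Sum.inr ((Rat.HeightOneSpectrum.primesEquiv (R := 𝓞 ℚ)).symm ⟨p, Fact.out⟩)))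
      (w₀.1.adicCompletion (CyclotomicField (cycLevel p k r) ℚ))) :=
    w₀.adicCompletionSemialgHom_continuous ℚ (CyclotomicField (cycLevel p k r) ℚ)
  haveI := isScalarTower_padic_place_adicCompletion p k r w₀ hv₀ hw₀ hcont
  -- the LEAD's (GAL_loc)
  have key := expStarOmega_galois (p := p)
    (valuation_place_lt_one p ((Rat.HeightOneSpectrum.primesEquiv (R := 𝓞 ℚ)).symm ⟨p, Fact.out⟩))
    (LocalField.valuation_adicCompletion_natCast_lt_one w₀.1 p hw₀) W
    (galRestrictPlace ((Rat.HeightOneSpectrum.primesEquiv (R := 𝓞 ℚ)).symm ⟨p, Fact.out⟩)) hcont δ' s hs _ hgK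
    (fun y x hyx => hg y x hyx) d dw hinjw hexw
    (fun y => by have h := hres y; rw [expStarOmegaHom_apply] at h; exact h) h₀ hh₀ c c' hcc''
  rw [expStarOmegaHom_apply, expStarOmegaHom_apply]
  exact key


/-! ## §3. `ZetaBody` (C3a) VERBATIM from (DEF₀) with `φ₀ = exp*_{w₀}`, (RES₀) and one class -/

set_option backward.isDefEq.respectTransparency false in
/-- ★ **`ZetaBody` (C3a) VERBATIM ⟸ (DEF₀) + (RES₀) + one class with `exp*_d ≠ 0`**, every level `(k, r)`
and every prime `p`: if the value datum `Λ` is read through `Ψ` by the single-completion recipe (DEF₀) of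
hKatoV2₀ with `φ₀ = expStarOmegaHom … dw …` the DEFINED dual exponential at `w₀` (twist family `g`,
transport `galAdicCompletionMap`), and hKatoV2₀'s data at `w₀` hold — Néron lines `d` at `v`, `dw` at `w₀`
with the Prop-1.2.3 binders, (RES₀), one class `h₀` with `exp*_d h₀ ≠ 0` — then
`Λ (σ · y) = (1 ⊗ σ̃) Λ(y)` for all `σ ∈ Γ_ℚ` (§2 ∘
`KimAtThreeFineKatoValueEquivarianceLocal.zetaBody_C3a_of_cocycleDef_of_galLoc` with
`s_{δ'} = absGaloisOuterConj ℚ_v L_{w₀} δ'⁻¹`).  No (GAL₀)/(GAL_D)/(GAL_loc) hypothesis remains.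
[cite: Kato2004Asterisque, §9.4 (p. 188)] [cite: Kato1993LNM1553, Ch. II §1.2.4 and Prop. 1.2.3]
[cite: NeukirchANT1999, Ch. I §9, Ch. II §9 Prop. (9.6), Ch. IV §1] -/
theorem zetaBody_C3a_of_cocycleDef_expStar
    (hU : ∀ τ, absGaloisRestrictTower ℚ (((Rat.HeightOneSpectrum.primesEquiv (R := 𝓞 ℚ)).symm ⟨p, Fact.out⟩).adicCompletion ℚ) (w₀.1.adicCompletion (CyclotomicField (cycLevel p k r) ℚ)) τ ∈ cycSubgroup p k r)
    (Λ : H1 (tateRep W p) (cycSubgroup p k r) →ₗ[ℤ_[p]] ℚ_[p] ⊗[ℚ] CyclotomicField (cycLevel p k r) ℚ)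
    (Ψ : ℚ_[p] ⊗[ℚ] CyclotomicField (cycLevel p k r) ℚ ≃ₐ[ℚ]
      (Π w : ((Rat.HeightOneSpectrum.primesEquiv (R := 𝓞 ℚ)).symm ⟨p, Fact.out⟩).Extension (𝓞 (CyclotomicField (cycLevel p k r) ℚ)), w.1.adicCompletion (CyclotomicField (cycLevel p k r) ℚ)))
    (hΨ : ∀ (s : ℚ_[p]) (x : CyclotomicField (cycLevel p k r) ℚ) (w : ((Rat.HeightOneSpectrum.primesEquiv (R := 𝓞 ℚ)).symm ⟨p, Fact.out⟩).Extension (𝓞 (CyclotomicField (cycLevel p k r) ℚ))),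
      Ψ (s ⊗ₜ[ℚ] x) w = algebraMap (CyclotomicField (cycLevel p k r) ℚ) (w.1.adicCompletion (CyclotomicField (cycLevel p k r) ℚ)) x *
        algebraMap (((Rat.HeightOneSpectrum.primesEquiv (R := 𝓞 ℚ)).symm ⟨p, Fact.out⟩).adicCompletion ℚ) (w.1.adicCompletion (CyclotomicField (cycLevel p k r) ℚ)) (Padic.adicCompletionEquiv (𝓞 ℚ) ⟨p, Fact.out⟩ s))
    (g : ((Rat.HeightOneSpectrum.primesEquiv (R := 𝓞 ℚ)).symm ⟨p, Fact.out⟩).Extension (𝓞 (CyclotomicField (cycLevel p k r) ℚ)) → absoluteGaloisGroup ℚ)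
    (hg : ∀ w : ((Rat.HeightOneSpectrum.primesEquiv (R := 𝓞 ℚ)).symm ⟨p, Fact.out⟩).Extension (𝓞 (CyclotomicField (cycLevel p k r) ℚ)),
      sigma (cycLevel p k r) (modNCyclotomicCharacter ℚ (cycLevel p k r) (g w)) • w.1 = w₀.1) :
    haveI : Fact (((p : ℕ) : 𝓞 ℚ) ∈ ((Rat.HeightOneSpectrum.primesEquiv (R := 𝓞 ℚ)).symm ⟨p, Fact.out⟩).asIdeal) := ⟨hv₀⟩
    letI := LocalField.charZero_adicCompletion w₀.1
    letI := LocalField.adicCompletionPadicAlgebra w₀.1 p hw₀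
    haveI : Fact (¬ IsUnit ((p : ℕ) : integerC (w₀.1.adicCompletion (CyclotomicField (cycLevel p k r) ℚ)))) := ⟨not_isUnit_natCast_integerC (LocalField.valuation_adicCompletion_natCast_lt_one w₀.1 p hw₀)⟩
    haveI := isAdicComplete_integerC_natCast (LocalField.valuation_adicCompletion_natCast_lt_one w₀.1 p hw₀)
    ∀ (d : LocalNeronLineAt W p ((Rat.HeightOneSpectrum.primesEquiv (R := 𝓞 ℚ)).symm ⟨p, Fact.out⟩))
      (dw : LocalNeronLine W (LocalField.valuation_adicCompletion_natCast_lt_one w₀.1 p hw₀) ((galRestrictPlace ((Rat.HeightOneSpectrum.primesEquiv (R := 𝓞 ℚ)).symm ⟨p, Fact.out⟩)).comp (absGaloisRestrict (((Rat.HeightOneSpectrum.primesEquiv (R := 𝓞 ℚ)).symm ⟨p, Fact.out⟩).adicCompletion ℚ) (w₀.1.adicCompletion (CyclotomicField (cycLevel p k r) ℚ)))))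
      (hinjw : (bdRPeriodRingData (LocalField.valuation_adicCompletion_natCast_lt_one w₀.1 p hw₀)).CupLogInjective (logCyclotomic p) (localRationalTateRep W p ((galRestrictPlace ((Rat.HeightOneSpectrum.primesEquiv (R := 𝓞 ℚ)).symm ⟨p, Fact.out⟩)).comp (absGaloisRestrict (((Rat.HeightOneSpectrum.primesEquiv (R := 𝓞 ℚ)).symm ⟨p, Fact.out⟩).adicCompletion ℚ) (w₀.1.adicCompletion (CyclotomicField (cycLevel p k r) ℚ))))))
      (hexw : ∀ z : contOneCocycles (localRationalTateRep W p ((galRestrictPlace ((Rat.HeightOneSpectrum.primesEquiv (R := 𝓞 ℚ)).symm ⟨p, Fact.out⟩)).comp (absGaloisRestrict (((Rat.HeightOneSpectrum.primesEquiv (R := 𝓞 ℚ)).symm ⟨p, Fact.out⟩).adicCompletion ℚ) (w₀.1.adicCompletion (CyclotomicField (cycLevel p k r) ℚ))))).toTopRep,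
        (bdRPeriodRingData (LocalField.valuation_adicCompletion_natCast_lt_one w₀.1 p hw₀)).HasDualExp (logCyclotomic p) (localRationalTateRep W p ((galRestrictPlace ((Rat.HeightOneSpectrum.primesEquiv (R := 𝓞 ℚ)).symm ⟨p, Fact.out⟩)).comp (absGaloisRestrict (((Rat.HeightOneSpectrum.primesEquiv (R := 𝓞 ℚ)).symm ⟨p, Fact.out⟩).adicCompletion ℚ) (w₀.1.adicCompletion (CyclotomicField (cycLevel p k r) ℚ))))) fun σ => z.1 σ),
      (∀ (h : (tateLocalRep W p (Sum.inr ((Rat.HeightOneSpectrum.primesEquiv (R := 𝓞 ℚ)).symm ⟨p, Fact.out⟩))).cohomology 1),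
        (expStarOmegaHom (LocalField.valuation_adicCompletion_natCast_lt_one w₀.1 p hw₀) ((galRestrictPlace ((Rat.HeightOneSpectrum.primesEquiv (R := 𝓞 ℚ)).symm ⟨p, Fact.out⟩)).comp (absGaloisRestrict (((Rat.HeightOneSpectrum.primesEquiv (R := 𝓞 ℚ)).symm ⟨p, Fact.out⟩).adicCompletion ℚ) (w₀.1.adicCompletion (CyclotomicField (cycLevel p k r) ℚ)))) dw hinjw hexw) (ContinuousRep.cohomologyRes (tateLocalRep W p (Sum.inr ((Rat.HeightOneSpectrum.primesEquiv (R := 𝓞 ℚ)).symm ⟨p, Fact.out⟩))) (absGaloisRestrict (((Rat.HeightOneSpectrum.primesEquiv (R := 𝓞 ℚ)).symm ⟨p, Fact.out⟩).adicCompletion ℚ) (w₀.1.adicCompletion (CyclotomicField (cycLevel p k r) ℚ))) 1 h) =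
          algebraMap (((Rat.HeightOneSpectrum.primesEquiv (R := 𝓞 ℚ)).symm ⟨p, Fact.out⟩).adicCompletion ℚ) (w₀.1.adicCompletion (CyclotomicField (cycLevel p k r) ℚ)) (expStarOmegaAt d h)) →
      ∀ (h₀ : (tateLocalRep W p (Sum.inr ((Rat.HeightOneSpectrum.primesEquiv (R := 𝓞 ℚ)).symm ⟨p, Fact.out⟩))).cohomology 1), expStarOmegaAt d h₀ ≠ 0 →
      (∀ (w : ((Rat.HeightOneSpectrum.primesEquiv (R := 𝓞 ℚ)).symm ⟨p, Fact.out⟩).Extension (𝓞 (CyclotomicField (cycLevel p k r) ℚ))) (y : H1 (tateRep W p) (cycSubgroup p k r))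
        (φ'' : contOneCocycles (subgroupRep (tateRep W p).toTopRep (cycSubgroup p k r)))
        (ψT : contOneCocycles ((tateLocalRep W p (Sum.inr ((Rat.HeightOneSpectrum.primesEquiv (R := 𝓞 ℚ)).symm ⟨p, Fact.out⟩))).restrict (absGaloisRestrict (((Rat.HeightOneSpectrum.primesEquiv (R := 𝓞 ℚ)).symm ⟨p, Fact.out⟩).adicCompletion ℚ) (w₀.1.adicCompletion (CyclotomicField (cycLevel p k r) ℚ)))).toTopRep),
        oneCocycleClass _ φ'' = conjMap (tateRep W p).toTopRep (cycSubgroup p k r) (g w) 1 y →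
        (∀ σ, ψT.1 σ = φ''.1 ⟨absGaloisRestrictTower ℚ (((Rat.HeightOneSpectrum.primesEquiv (R := 𝓞 ℚ)).symm ⟨p, Fact.out⟩).adicCompletion ℚ) (w₀.1.adicCompletion (CyclotomicField (cycLevel p k r) ℚ)) σ, hU σ⟩) →
        Ψ (Λ y) w = galAdicCompletionMap
          (sigma (cycLevel p k r) (modNCyclotomicCharacter ℚ (cycLevel p k r) (g w)))⁻¹
          (inv_smul_eq_of_smul_eq (hg w)) ((expStarOmegaHom (LocalField.valuation_adicCompletion_natCast_lt_one w₀.1 p hw₀) ((galRestrictPlace ((Rat.HeightOneSpectrum.primesEquiv (R := 𝓞 ℚ)).symm ⟨p, Fact.out⟩)).comp (absGaloisRestrict (((Rat.HeightOneSpectrum.primesEquiv (R := 𝓞 ℚ)).symm ⟨p, Fact.out⟩).adicCompletion ℚ) (w₀.1.adicCompletion (CyclotomicField (cycLevel p k r) ℚ)))) dw hinjw hexw) (oneCocycleClass _ ψT))) →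
      ∀ (σ : absoluteGaloisGroup ℚ) (y : H1 (tateRep W p) (cycSubgroup p k r)),
        Λ (conjMap (tateRep W p).toTopRep (cycSubgroup p k r) σ 1 y) =
          Algebra.TensorProduct.map (AlgHom.id ℚ ℚ_[p])
            (sigma (cycLevel p k r) (modNCyclotomicCharacter ℚ (cycLevel p k r) σ) :
              CyclotomicField (cycLevel p k r) ℚ →ₐ[ℚ] CyclotomicField (cycLevel p k r) ℚ) (Λ y) := by
  intro d dw hinjw hexw hres h₀ hh₀ hdef σ y
  haveI : Fact (((p : ℕ) : 𝓞 ℚ) ∈ ((Rat.HeightOneSpectrum.primesEquiv (R := 𝓞 ℚ)).symm ⟨p, Fact.out⟩).asIdeal) := ⟨hv₀⟩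
  haveI := LocalField.charZero_adicCompletion w₀.1
  letI := LocalField.adicCompletionPadicAlgebra w₀.1 p hw₀
  haveI : Fact (¬ IsUnit ((p : ℕ) : integerC (w₀.1.adicCompletion (CyclotomicField (cycLevel p k r) ℚ)))) :=
    ⟨not_isUnit_natCast_integerC (LocalField.valuation_adicCompletion_natCast_lt_one w₀.1 p hw₀)⟩
  haveI := isAdicComplete_integerC_natCast (LocalField.valuation_adicCompletion_natCast_lt_one w₀.1 p hw₀)
  haveI := isGalois_adicCompletion_cyclotomicField (cycLevel p k r) ((Rat.HeightOneSpectrum.primesEquiv (R := 𝓞 ℚ)).symm ⟨p, Fact.out⟩) w₀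
  letI instKL : Algebra (Place.Completion (Sum.inr ((Rat.HeightOneSpectrum.primesEquiv (R := 𝓞 ℚ)).symm ⟨p, Fact.out⟩))) (w₀.1.adicCompletion (CyclotomicField (cycLevel p k r) ℚ)) := (inferInstance : Algebra (((Rat.HeightOneSpectrum.primesEquiv (R := 𝓞 ℚ)).symm ⟨p, Fact.out⟩).adicCompletion ℚ) (w₀.1.adicCompletion (CyclotomicField (cycLevel p k r) ℚ)))
  have hs : ∀ (δ' : absoluteGaloisGroup (((Rat.HeightOneSpectrum.primesEquiv (R := 𝓞 ℚ)).symm ⟨p, Fact.out⟩).adicCompletion ℚ)) (τ : absoluteGaloisGroup (w₀.1.adicCompletion (CyclotomicField (cycLevel p k r) ℚ))),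
      absGaloisRestrict (((Rat.HeightOneSpectrum.primesEquiv (R := 𝓞 ℚ)).symm ⟨p, Fact.out⟩).adicCompletion ℚ) (w₀.1.adicCompletion (CyclotomicField (cycLevel p k r) ℚ)) (absGaloisOuterConj (((Rat.HeightOneSpectrum.primesEquiv (R := 𝓞 ℚ)).symm ⟨p, Fact.out⟩).adicCompletion ℚ) (w₀.1.adicCompletion (CyclotomicField (cycLevel p k r) ℚ)) δ'⁻¹ τ) = δ'⁻¹ * absGaloisRestrict (((Rat.HeightOneSpectrum.primesEquiv (R := 𝓞 ℚ)).symm ⟨p, Fact.out⟩).adicCompletion ℚ) (w₀.1.adicCompletion (CyclotomicField (cycLevel p k r) ℚ)) τ * δ' :=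
    fun δ' τ => by
    have h := absGaloisRestrict_absGaloisOuterConj (((Rat.HeightOneSpectrum.primesEquiv (R := 𝓞 ℚ)).symm ⟨p, Fact.out⟩).adicCompletion ℚ) (w₀.1.adicCompletion (CyclotomicField (cycLevel p k r) ℚ)) δ'⁻¹ τ
    rw [inv_inv] at h
    exact h
  exact zetaBody_C3a_of_cocycleDef_of_galLoc W p k r w₀ hU (expStarOmegaHom (LocalField.valuation_adicCompletion_natCast_lt_one w₀.1 p hw₀) ((galRestrictPlace ((Rat.HeightOneSpectrum.primesEquiv (R := 𝓞 ℚ)).symm ⟨p, Fact.out⟩)).comp (absGaloisRestrict (((Rat.HeightOneSpectrum.primesEquiv (R := 𝓞 ℚ)).symm ⟨p, Fact.out⟩).adicCompletion ℚ) (w₀.1.adicCompletion (CyclotomicField (cycLevel p k r) ℚ)))) dw hinjw hexw) Λ Ψ hΨ g hg hdef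
    (fun δ' => ⇑(absGaloisOuterConj (((Rat.HeightOneSpectrum.primesEquiv (R := 𝓞 ℚ)).symm ⟨p, Fact.out⟩).adicCompletion ℚ) (w₀.1.adicCompletion (CyclotomicField (cycLevel p k r) ℚ)) δ'⁻¹)) (fun δ' τ => hs δ' τ)
    (fun δ' hδ c c' hcc' => galLoc_expStarOmegaHom W p k r w₀ hv₀ hw₀ d dw hinjw hexw hres h₀ hh₀ δ' hδ
      (absGaloisOuterConj (((Rat.HeightOneSpectrum.primesEquiv (R := 𝓞 ℚ)).symm ⟨p, Fact.out⟩).adicCompletion ℚ) (w₀.1.adicCompletion (CyclotomicField (cycLevel p k r) ℚ)) δ'⁻¹) (hs δ') c c' hcc') σ y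

end Summit.BirchSwinnertonDyer.BirchSwinnertonDyer.Theorems.KimAtThreeFineKatoValueEquivarianceExpStar

end
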